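import Summits.QuantumFields.YangMills.Theorems.ColdStartUniversalityLatticeLangevinWilsonInvariantBetaZero
import HarnessLib

/-!
# Route `ColdStartUniversality`, crux K_A1 `UniformColdStartMixing` (stmt-QuantumFields-24809), rung `stub_fixedCutoffMixing`:
# (Inv) groundwork I1a — Haar orthogonality of latitude eigenfunctions of different degrees

Helper file (seat `ym-line-csu-p1`, g7).  Per link: `∫ U_m(⟨ρ g, ρ V⟩/2) U_n(⟨ρ h, ρ V⟩/2) dHaar(V) = [m = n] U_m(⟨ρ g, ρ h⟩/2)/(m+1)`
(translated characters `χ_m(V g⁻¹)`, the convolution identity `integral_su2Char_mul_su2Char_inv_mul`, right invariance);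
on `SU(2)^E`: products over the links factor (`integral_fintype_prod_eq_prod`), so two products of latitude eigenfunctions with
different degree vectors are Haar-orthogonal (`integral_prod_gegenbauer_mul_prod_gegenbauer_pi_haar`).  This is the input of the
Haar-symmetry of the `β' = 0` semigroup on ridge form (step I1 of the (Inv) plan).  No definition, no sorry.  RECORD-rung R3 plumbing.
-/

set_option autoImplicit false

noncomputable section

namespace Summit.QuantumFields.YangMills.Theorems.ColdStartUniversality

open MeasureTheory Finset
open scoped BigOperators
open Literature.MathematicalPhysics.QuantumFieldTheory Tomboulis2007
open Literature.MathematicalPhysics.QuantumLattice (fundamentalRep)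
open Literature.Analysis.SpecialFunctions (gegenbauerSum)

/-- **Per link**: `∫ U_m(⟨ρ g, ρ V⟩/2) U_n(⟨ρ h, ρ V⟩/2) dHaar(V) = [m = n] · U_m(⟨ρ g, ρ h⟩/2)/(m+1)`. [folklore] -/
theorem integral_gegenbauer_latitude_mul (m n : ℕ) (g h : Matrix.specialUnitaryGroup (Fin 2) ℂ) :
    ∫ V, gegenbauerSum 1 m (hsForm 2 (fundamentalRep (Fin 2) g) (fundamentalRep (Fin 2) V) / 2) *
        gegenbauerSum 1 n (hsForm 2 (fundamentalRep (Fin 2) h) (fundamentalRep (Fin 2) V) / 2)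
      ∂(haarProbability (Matrix.specialUnitaryGroup (Fin 2) ℂ)) =
      if m = n then gegenbauerSum 1 m (hsForm 2 (fundamentalRep (Fin 2) g) (fundamentalRep (Fin 2) h) / 2) / ((m : ℝ) + 1)
      else 0 := by
  haveI : IsProbabilityMeasure (haarProbability (Matrix.specialUnitaryGroup (Fin 2) ℂ)) := inferInstance
  haveI := YM2.isMulRightInvariant_haarProbability (Matrix.specialUnitaryGroup (Fin 2) ℂ)
  simp_rw [← su2Char_mul_inv_eq_gegenbauerSum]
  -- `V ↦ V g` : `∫ χ_m(V g⁻¹) χ_n(V h⁻¹) dV = ∫ χ_m(V) χ_n(V⁻¹ (h g⁻¹)) dV`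
  have hsub : ∫ V, su2Char m (V * g⁻¹) * su2Char n (V * h⁻¹) ∂(haarProbability (Matrix.specialUnitaryGroup (Fin 2) ℂ)) =
      ∫ V, su2Char m V * su2Char n (V⁻¹ * (h * g⁻¹)) ∂(haarProbability (Matrix.specialUnitaryGroup (Fin 2) ℂ)) := by
    rw [← integral_mul_right_eq_self (fun V => su2Char m (V * g⁻¹) * su2Char n (V * h⁻¹)) g]
    refine integral_congr_ae (Filter.Eventually.of_forall fun V => ?_)
    simp only [mul_inv_cancel_right]
    congr 1
    rw [← su2Char_inv n (V * g * h⁻¹), mul_inv_rev, mul_inv_rev, inv_inv, ← mul_assoc, su2Char_mul_comm]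
  rw [hsub, Tomboulis2007.SU2SymPow.integral_su2Char_mul_su2Char_inv_mul m n (h * g⁻¹)]
  by_cases hmn : m = n
  · subst hmn; simp
  · simp [hmn]

variable {L : ℕ} [NeZero L]

/-- **Haar orthogonality of products of latitude eigenfunctions on `SU(2)^E`**: the pairing of two ridge products is
`∏_e [m_e = n_e] U_{m_e}(⟨ρ g_e, ρ h_e⟩/2)/(m_e+1)`; in particular it vanishes unless the degree vectors agree. [folklore] -/
theorem integral_prod_gegenbauer_mul_prod_gegenbauer_pi_haar (g h : Edge 3 L → Matrix.specialUnitaryGroup (Fin 2) ℂ)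
    (m n : Edge 3 L → ℕ) :
    ∫ y, (∏ e, gegenbauerSum 1 (m e) (hsForm 2 (fundamentalRep (Fin 2) (g e)) (fundamentalRep (Fin 2) (y e)) / 2)) *
        (∏ e, gegenbauerSum 1 (n e) (hsForm 2 (fundamentalRep (Fin 2) (h e)) (fundamentalRep (Fin 2) (y e)) / 2))
      ∂(Measure.pi fun _ : Edge 3 L => haarProbability (Matrix.specialUnitaryGroup (Fin 2) ℂ)) =
      ∏ e, (if m e = n e then gegenbauerSum 1 (m e)
        (hsForm 2 (fundamentalRep (Fin 2) (g e)) (fundamentalRep (Fin 2) (h e)) / 2) / ((m e : ℝ) + 1) else 0) := by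
  classical
  haveI : IsProbabilityMeasure (haarProbability (Matrix.specialUnitaryGroup (Fin 2) ℂ)) := inferInstance
  simp_rw [← Finset.prod_mul_distrib]
  rw [integral_fintype_prod_eq_prod (𝕜 := ℝ)
    (f := fun e (x : Matrix.specialUnitaryGroup (Fin 2) ℂ) =>
      gegenbauerSum 1 (m e) (hsForm 2 (fundamentalRep (Fin 2) (g e)) (fundamentalRep (Fin 2) x) / 2) *
        gegenbauerSum 1 (n e) (hsForm 2 (fundamentalRep (Fin 2) (h e)) (fundamentalRep (Fin 2) x) / 2))]
  exact Finset.prod_congr rfl fun e _ => integral_gegenbauer_latitude_mul (m e) (n e) (g e) (h e)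

/-- In particular the pairing vanishes unless the degree vectors agree. [folklore] -/
theorem integral_prod_gegenbauer_mul_prod_gegenbauer_pi_haar_eq_zero (g h : Edge 3 L → Matrix.specialUnitaryGroup (Fin 2) ℂ)
    {m n : Edge 3 L → ℕ} (hmn : m ≠ n) :
    ∫ y, (∏ e, gegenbauerSum 1 (m e) (hsForm 2 (fundamentalRep (Fin 2) (g e)) (fundamentalRep (Fin 2) (y e)) / 2)) *
        (∏ e, gegenbauerSum 1 (n e) (hsForm 2 (fundamentalRep (Fin 2) (h e)) (fundamentalRep (Fin 2) (y e)) / 2))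
      ∂(Measure.pi fun _ : Edge 3 L => haarProbability (Matrix.specialUnitaryGroup (Fin 2) ℂ)) = 0 := by
  classical
  rw [integral_prod_gegenbauer_mul_prod_gegenbauer_pi_haar]
  obtain ⟨e, he⟩ := Function.ne_iff.1 hmn
  exact Finset.prod_eq_zero (Finset.mem_univ e) (if_neg he)

end Summit.QuantumFields.YangMills.Theorems.ColdStartUniversality

end
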